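import Summits.QuantumFields.YangMills.Theorems.ParabolicTrajectoryLatticeGapOnTrajectoryTransferHankelTorus
import Literature.MathematicalPhysics.QuantumFieldTheory.SpeciesTimeReflection
import Literature.MathematicalPhysics.QuantumLattice.ReflectedCorrelationPolarisationSlack
import HarnessLib

/-!
# Crux `LatticeGapOnTrajectory` (stmt-QuantumFields-10523): Hankel log-convexity for the SITE
# reflection of the odd Wilson torus, and multiplicative polarisation (transfer infrastructure, lead c2)

Helper file (`--supports stmt-QuantumFields-10523`) for the registered stub `stub_transferSym` of the
line `orbit-kantorovich-finite-size` (reshape 4). The continuum side of the transfer identifies OS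
variances `osVar μ_k Θ₀ X_k` for the torus SITE reflection `Θ₀ = GaugeConfig.negReflect` (`t ↦ −t`,
the reflection compatible with the continuum test-function reflection: `tendsto_osVar_rep`), so the
Hankel chain of `…TransferHankelTorus` (stated there for the link reflection `GaugeConfig.timeReflect`)
is re-instantiated here for `Θ₀`:

* `torusConfigShift_negReflect_comm` — the intertwining `τ_v ∘ Θ₀ = Θ₀ ∘ τ_{−v}`;
* `osVar_negReflect_nonneg_of_rp` — reflection positivity for `Θ₀` on slab observables (a
  HYPOTHESIS here, in the raw form of the registered stub `stub_negReflectRP`) in OS-variance form;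
* **`norm_osCorr_negReflect_pow_le`**, **`norm_osCorr_negReflect_le_of_decay`** — for a bounded
  measurable `X` depending on the links based at times `1 … w` and `2^J m + w ≤ S`:
  `‖osCorr μ Θ₀ τ_m X X‖^(2^J) ≤ (osVar μ Θ₀ X)^(2^J−1) ‖osCorr μ Θ₀ τ_(2^J m) X X‖`, hence a far bound
  `C e^{−κ 2^J m}` gives `‖osCorr μ Θ₀ τ_m X X‖ ≤ ((osVar X)^(2^J−1) C)^{2^{−J}} e^{−κm}`;
* `norm_osCorr_le_of_diag_bound` — abstract multiplicative polarisation: a diagonal bound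
  `‖osCorr τ Z Z‖ ≤ Φ(osVar Z, B_Z)` with `Φ` monotone on the non-negative quadrant gives
  `‖osCorr τ X Y‖ ≤ Φ(2(osVar X + osVar Y), B_X + B_Y)`.

References: Osterwalder–Seiler 1978 §2; Glimm–Jaffe 1987 §6.1, §19.7; Fröhlich–Israel–Lieb–Simon 1978 §2.
-/

open scoped ComplexConjugate ComplexOrder
open Filter MeasureTheory
open Literature.MathematicalPhysics.QuantumLattice Literature.MathematicalPhysics.QuantumFieldTheory

noncomputable section

namespace Summit.QuantumFields.YangMills.Cruxes.LatticeGapOnTrajectory.OrbitKantorovichFiniteSize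

namespace Transfer

namespace HankelSite

/-! ## §1 Abstract multiplicative polarisation -/

section Polarisation

variable {Ω : Type*} [MeasurableSpace Ω] {μ : Measure Ω} [IsFiniteMeasure μ] {Θ τ : Ω → Ω}

/-- **Multiplicative polarisation.** On a class `Good` of measurable functions closed under
`X + c • Y` with non-negative OS variances: if every good `Z` with sup bound `B` satisfies a
diagonal bound `‖osCorr τ (Z, Z)‖ ≤ Φ(osVar Z, B)` with `Φ` monotone in both arguments on the
non-negative quadrant, then for good `X, Y` with sup bounds `B_X, B_Y ≥ 0`,
`‖osCorr τ (X, Y)‖ ≤ Φ(2(osVar X + osVar Y), B_X + B_Y)`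
(`4 osCorr(X, Y) = Σ_{c ∈ {1,−1,i,−i}} c̄ osCorr(X + cY, X + cY)`, `osVar(X + cY) ≤ 2 osVar X + 2 osVar Y`).
[cite: GlimmJaffe1987, §6.1] -/
theorem norm_osCorr_le_of_diag_bound (hΘ : Measurable Θ) (hτ : Measurable τ)
    {Good : (Ω → ℂ) → Prop} (hmeas : ∀ X, Good X → Measurable X)
    (hadd : ∀ X Y (c : ℂ), Good X → Good Y → Good (X + c • Y))
    (hvar : ∀ Z, Good Z → 0 ≤ osVar μ Θ Z) {Φ : ℝ → ℝ → ℝ}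
    (hΦ : ∀ v v' b b' : ℝ, 0 ≤ v → v ≤ v' → 0 ≤ b → b ≤ b' → Φ v b ≤ Φ v' b')
    (hdiag : ∀ Z (B : ℝ), Good Z → (∀ ω, ‖Z ω‖ ≤ B) → ‖osCorr μ Θ τ Z Z‖ ≤ Φ (osVar μ Θ Z) B)
    {X Y : Ω → ℂ} (hX : Good X) (hY : Good Y) {BX BY : ℝ} (hBX0 : 0 ≤ BX) (hBY0 : 0 ≤ BY)
    (hBX : ∀ ω, ‖X ω‖ ≤ BX) (hBY : ∀ ω, ‖Y ω‖ ≤ BY) :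
    ‖osCorr μ Θ τ X Y‖ ≤ Φ (2 * (osVar μ Θ X + osVar μ Θ Y)) (BX + BY) := by
  -- adapted from `ReflectedCorrelationPolarisationSlack` (`norm_osCorr_le_of_gap_slack`)
  have hXm := hmeas X hX
  have hYm := hmeas Y hY
  have hXb : ∃ B, ∀ ω, ‖X ω‖ ≤ B := ⟨BX, hBX⟩
  have hYb : ∃ B, ∀ ω, ‖Y ω‖ ≤ B := ⟨BY, hBY⟩
  have key : ∀ c : ℂ, ‖c‖ = 1 → ‖osCorr μ Θ τ (X + c • Y) (X + c • Y)‖ ≤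
      Φ (2 * (osVar μ Θ X + osVar μ Θ Y)) (BX + BY) := by
    intro c hc
    have hZ := hadd X Y c hX hY
    have h := hdiag _ (BX + BY) hZ (norm_add_smul_le_of_norm_eq_one hBX hBY hc)
    have hpar := osVar_add_smul_le_of_slack (μ := μ) (δ := 0) hΘ hmeas hadd
      (fun Z B hZ' _ => by simpa using hvar Z hZ') hX hY hBX hBY hc
    refine h.trans (hΦ _ _ _ _ (hvar _ hZ) (by linarith) (by positivity) le_rfl)
  -- polarisation identity
  have hpol : (4 : ℂ) * osCorr μ Θ τ X Y =
      osCorr μ Θ τ (X + (1 : ℂ) • Y) (X + (1 : ℂ) • Y) -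
        osCorr μ Θ τ (X + (-1 : ℂ) • Y) (X + (-1 : ℂ) • Y) -
        Complex.I * osCorr μ Θ τ (X + Complex.I • Y) (X + Complex.I • Y) +
        Complex.I * osCorr μ Θ τ (X + (-Complex.I) • Y) (X + (-Complex.I) • Y) := by
    rw [osCorr_add_smul hΘ hτ hXm hXb hYm hYb, osCorr_add_smul hΘ hτ hXm hXb hYm hYb,
      osCorr_add_smul hΘ hτ hXm hXb hYm hYb, osCorr_add_smul hΘ hτ hXm hXb hYm hYb]
    simp only [map_one, map_neg, Complex.conj_I]
    linear_combination (2 * (osCorr μ Θ τ X Y - osCorr μ Θ τ Y X)) * Complex.I_mul_I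
  have h1 := key 1 (by simp)
  have h2 := key (-1) (by simp)
  have h3 := key Complex.I (by simp)
  have h4 := key (-Complex.I) (by simp)
  have h4n : ‖(4 : ℂ) * osCorr μ Θ τ X Y‖ ≤ 4 * Φ (2 * (osVar μ Θ X + osVar μ Θ Y)) (BX + BY) := by
    rw [hpol]
    refine (norm_add_le _ _).trans ?_
    refine (add_le_add (norm_sub_le _ _) le_rfl).trans ?_
    refine (add_le_add (add_le_add (norm_sub_le _ _) le_rfl) le_rfl).trans ?_
    simp only [norm_mul, Complex.norm_I, one_mul]
    linarith
  rw [norm_mul] at h4n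
  have h4' : ‖(4 : ℂ)‖ = 4 := by simp
  rw [h4'] at h4n
  linarith

end Polarisation

variable {G : Type} [Group G] [TopologicalSpace G] [IsTopologicalGroup G] [CompactSpace G]
  [MeasurableSpace G] [BorelSpace G] {N : ℕ} (ρ : G →* Matrix (Fin N) (Fin N) ℂ)

/-! ## §2 Geometry of the time shift and the site reflection -/

section Geometry

variable {Sd : ℕ}

omit [TopologicalSpace G] [IsTopologicalGroup G] [CompactSpace G] [MeasurableSpace G] [BorelSpace G] in
/-- Reflecting a time-translated site: `θ₀ (x − c e₀) = θ₀ x + c e₀` for `θ₀ t = −t`. [folklore] -/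
theorem negReflect_sub_single [NeZero Sd] (x : Site 4 Sd) (c : ZMod Sd) :
    (x - Pi.single 0 c).negReflect = x.negReflect + Pi.single 0 c := by
  funext k
  by_cases hk : k = 0
  · subst hk
    simp only [WilsonSiteRP.negReflect_apply_zero, Pi.sub_apply, Pi.add_apply, Pi.single_eq_same]
    ring
  · simp only [WilsonSiteRP.negReflect_apply_of_ne _ hk, Pi.sub_apply, Pi.add_apply,
      Pi.single_eq_of_ne hk, sub_zero, add_zero]

omit [TopologicalSpace G] [IsTopologicalGroup G] [CompactSpace G] [MeasurableSpace G] [BorelSpace G] in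
/-- Reflecting a time-translated link: `siteEdgeReflect (x − c e₀, i) = ((siteEdgeReflect (x, i)).1 + c e₀, i)`.
[folklore] -/
theorem siteEdgeReflect_sub_single [NeZero Sd] (x : Site 4 Sd) (i : Fin 4) (c : ZMod Sd) :
    WilsonSiteRP.siteEdgeReflect (x - Pi.single 0 c, i) =
      ((WilsonSiteRP.siteEdgeReflect (x, i)).1 + Pi.single 0 c, i) := by
  unfold WilsonSiteRP.siteEdgeReflect
  by_cases hi : i = 0
  · subst hi
    simp only [↓reduceIte, Prod.mk.injEq, and_true]
    have : (x - Pi.single 0 c).shift 0 = x.shift 0 - Pi.single 0 c := by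
      simp only [Site.shift]; abel
    rw [this, negReflect_sub_single]
  · simp only [hi, ↓reduceIte, Prod.mk.injEq, and_true]
    exact negReflect_sub_single x c

omit [TopologicalSpace G] [IsTopologicalGroup G] [CompactSpace G] [BorelSpace G] in
/-- **The intertwining `τ_v ∘ Θ₀ = Θ₀ ∘ τ_{−v}`** for a time translation `v = c e₀` on the torus and
the site reflection: `torusConfigShift v (Θ₀U) = Θ₀ (torusConfigShift (−v) U)`. [folklore] -/
theorem torusConfigShift_negReflect_comm [NeZero Sd] (c : ZMod Sd) (U : GaugeConfig 4 Sd G) :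
    torusConfigShift (Pi.single 0 c) U.negReflect =
      (torusConfigShift (-Pi.single 0 c) U).negReflect := by
  funext e
  obtain ⟨x, i⟩ := e
  rw [torusConfigShift_apply, WilsonSiteRP.negReflect_apply, WilsonSiteRP.negReflect_apply]
  simp only [torusConfigShift_apply, sub_neg_eq_add]
  rw [siteEdgeReflect_sub_single]
  by_cases hi : i = 0
  · simp only [hi, ↓reduceIte]
    unfold WilsonSiteRP.siteEdgeReflect
    simp
  · simp only [hi, ↓reduceIte]
    unfold WilsonSiteRP.siteEdgeReflect
    simp [hi]

omit [Group G] [TopologicalSpace G] [IsTopologicalGroup G] [CompactSpace G] [BorelSpace G] in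
/-- A slab `a … b` with `1 ≤ a`, `b ≤ c` lies inside the slab `1 … c`. [folklore] -/
theorem slab_subset_slab {a b c : ℕ} (ha : 1 ≤ a) (hb : b ≤ c) :
    {e : Edge 4 Sd | a ≤ (e.1 0).val ∧ (e.1 0).val ≤ b} ⊆
      {e : Edge 4 Sd | 1 ≤ (e.1 0).val ∧ (e.1 0).val ≤ c} := by
  intro e he
  simp only [Set.mem_setOf_eq] at he ⊢
  exact ⟨ha.trans he.1, he.2.trans hb⟩

end Geometry

/-! ## §3 Reflection positivity for the site reflection in OS-variance form (from the raw hypothesis) -/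

section RP

variable {S : ℕ}

/-- **Site reflection positivity in OS-variance form.** If `∫ conj F(Θ₀U) F(U) dμ ≥ 0` for every
bounded measurable `F` depending on the links based at times `1 … w` (`w ≤ S`) — the raw form of
the registered stub `stub_negReflectRP` — then `0 ≤ osVar μ Θ₀ Z` for every such `Z`
(`μ = wilsonMeasure ρ β` on the torus of side `2S+1`): apply the hypothesis to the centred
observable `Z − ∫Z`. [cite: OsterwalderSeiler1978, §2] -/
theorem osVar_negReflect_nonneg_of_rp (hρ : Continuous ρ) (β : ℝ)
    (hRP : ∀ (F : GaugeConfig 4 (2 * S + 1) G → ℂ), Measurable F → (∃ C : ℝ, ∀ U, ‖F U‖ ≤ C) →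
      ∀ {w : ℕ}, w ≤ S → DependsOn F {e : Edge 4 (2 * S + 1) | 1 ≤ (e.1 0).val ∧ (e.1 0).val ≤ w} →
        0 ≤ wilsonExpectation ρ β fun U => conj (F U.negReflect) * F U)
    {Z : GaugeConfig 4 (2 * S + 1) G → ℂ} (hZ : Measurable Z) (hZb : ∃ B, ∀ U, ‖Z U‖ ≤ B)
    {w : ℕ} (hw : w ≤ S)
    (hZd : DependsOn Z {e : Edge 4 (2 * S + 1) | 1 ≤ (e.1 0).val ∧ (e.1 0).val ≤ w}) :
    0 ≤ osVar (wilsonMeasure (d := 4) (L := 2 * S + 1) ρ β) GaugeConfig.negReflect Z := by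
  -- adapted from `…TransferHankelTorus` (`osVar_timeReflect_nonneg`)
  set μ := wilsonMeasure (d := 4) (L := 2 * S + 1) (G := G) ρ β with hμ
  haveI := isProbabilityMeasure_wilsonMeasure (d := 4) (L := 2 * S + 1) ρ hρ β
  have hΘ : MeasurePreserving (GaugeConfig.negReflect : GaugeConfig 4 (2 * S + 1) G → _) μ μ :=
    measurePreserving_negReflect_wilsonMeasure ρ hρ β
  obtain ⟨B, hB⟩ := hZb
  set c : ℂ := ∫ U, Z U ∂μ with hc
  set W : GaugeConfig 4 (2 * S + 1) G → ℂ := fun U => Z U - c with hW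
  have hWm : Measurable W := hZ.sub measurable_const
  have hWb : ∃ C : ℝ, ∀ U, ‖W U‖ ≤ C := ⟨B + ‖c‖, fun U => (norm_sub_le _ _).trans (by
    have := hB U; linarith)⟩
  have hWd : DependsOn W {e : Edge 4 (2 * S + 1) | 1 ≤ (e.1 0).val ∧ (e.1 0).val ≤ w} :=
    fun U V h => by
      show Z U - c = Z V - c
      rw [hZd h]
  have hRPW := hRP W hWm hWb hw hWd
  have hZi : Integrable Z μ := integrable_of_measurable_bounded hZ ⟨B, hB⟩
  have hZΘ : Integrable (fun U => conj (Z U.negReflect)) μ :=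
    integrable_of_measurable_bounded (Complex.continuous_conj.measurable.comp
      (hZ.comp WilsonSiteRP.measurable_negReflect)) ⟨B, fun U => by rw [RCLike.norm_conj]; exact hB _⟩
  have hZZ : Integrable (fun U => conj (Z U.negReflect) * Z U) μ :=
    integrable_conj_comp_mul_comp (τ := id) WilsonSiteRP.measurable_negReflect measurable_id hZ ⟨B, hB⟩
      hZ ⟨B, hB⟩
  have hcΘ : ∫ U, conj (Z U.negReflect) ∂μ = conj c := by
    rw [integral_conj, hc]
    exact congrArg _ (integral_comp_eq_of_measurePreserving hΘ hZ)
  have hkey : (∫ U, conj (W U.negReflect) * W U ∂μ) = osCorr μ GaugeConfig.negReflect id Z Z := by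
    have e : ∀ U, conj (W U.negReflect) * W U =
        conj (Z U.negReflect) * Z U - c * conj (Z U.negReflect) - conj c * Z U + conj c * c := by
      intro U; simp only [hW, map_sub]; ring
    simp_rw [e]
    rw [integral_add, integral_sub, integral_sub, integral_const_mul, integral_const_mul, hcΘ,
      integral_const, hc]
    · simp only [probReal_univ, one_smul, osCorr, id_eq]
      ring
    · exact hZZ
    · exact hZΘ.const_mul c
    · exact hZZ.sub (hZΘ.const_mul c)
    · exact hZi.const_mul _
    · exact (hZZ.sub (hZΘ.const_mul c)).sub (hZi.const_mul _)
    · exact integrable_const _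
  unfold osVar
  rw [← hkey]
  exact (Complex.nonneg_iff.1 hRPW).1

end RP

/-! ## §4 Log-convexity and OS-currency decay for the site reflection -/

section Main

variable {S : ℕ}

/-- **Hankel log-convexity for the site reflection of the odd Wilson torus.** Let
`μ = wilsonMeasure ρ β` on `GaugeConfig 4 (2S+1) G`, `Θ₀ = GaugeConfig.negReflect`,
`τ_m = torusTimeShift (2S+1) m`, and assume site reflection positivity on slab observables (raw
form of `stub_negReflectRP`). For a bounded measurable `X` depending only on the links based at
lattice times `1 … w` and `2^J m + w ≤ S`,
`‖osCorr μ Θ₀ τ_m X X‖^(2^J) ≤ (osVar μ Θ₀ X)^(2^J − 1) · ‖osCorr μ Θ₀ τ_(2^J m) X X‖`.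
[cite: FrohlichIsraelLiebSimon1978, §2] -/
theorem norm_osCorr_negReflect_pow_le (hρ : Continuous ρ) (β : ℝ)
    (hRP : ∀ (F : GaugeConfig 4 (2 * S + 1) G → ℂ), Measurable F → (∃ C : ℝ, ∀ U, ‖F U‖ ≤ C) →
      ∀ {w : ℕ}, w ≤ S → DependsOn F {e : Edge 4 (2 * S + 1) | 1 ≤ (e.1 0).val ∧ (e.1 0).val ≤ w} →
        0 ≤ wilsonExpectation ρ β fun U => conj (F U.negReflect) * F U)
    {X : GaugeConfig 4 (2 * S + 1) G → ℂ} (hX : Measurable X) (hXb : ∃ B, ∀ U, ‖X U‖ ≤ B) {w : ℕ}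
    (hXd : DependsOn X {e : Edge 4 (2 * S + 1) | 1 ≤ (e.1 0).val ∧ (e.1 0).val ≤ w})
    {J m : ℕ} (hJm : 2 ^ J * m + w ≤ S) :
    ‖osCorr (wilsonMeasure (d := 4) (L := 2 * S + 1) ρ β) GaugeConfig.negReflect
        (torusTimeShift (2 * S + 1) m) X X‖ ^ (2 ^ J) ≤
      osVar (wilsonMeasure (d := 4) (L := 2 * S + 1) ρ β) GaugeConfig.negReflect X ^ (2 ^ J - 1) *
        ‖osCorr (wilsonMeasure (d := 4) (L := 2 * S + 1) ρ β) GaugeConfig.negReflect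
          (torusTimeShift (2 * S + 1) (2 ^ J * m)) X X‖ := by
  -- adapted from `…TransferHankelTorus` (`norm_osCorr_timeShift_pow_le`), reflection `negReflect`
  set μ := wilsonMeasure (d := 4) (L := 2 * S + 1) (G := G) ρ β with hμ
  haveI := isProbabilityMeasure_wilsonMeasure (d := 4) (L := 2 * S + 1) ρ hρ β
  have hΘm : Measurable (GaugeConfig.negReflect : GaugeConfig 4 (2 * S + 1) G → _) :=
    WilsonSiteRP.measurable_negReflect
  have hΘ : MeasurePreserving (GaugeConfig.negReflect : GaugeConfig 4 (2 * S + 1) G → _) μ μ :=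
    measurePreserving_negReflect_wilsonMeasure ρ hρ β
  have hΘΘ : ∀ U : GaugeConfig 4 (2 * S + 1) G, U.negReflect.negReflect = U :=
    WilsonSiteRP.negReflect_negReflect_config
  have hτ : MeasurePreserving (⇑(torusTimeShift (G := G) (2 * S + 1) 1)) μ μ :=
    ⟨(torusTimeShift _ _).measurable, by
      unfold torusTimeShift; exact wilsonMeasure_map_torusConfigShift ρ β _⟩
  set σ : GaugeConfig 4 (2 * S + 1) G → GaugeConfig 4 (2 * S + 1) G :=
    ⇑(torusConfigShift (G := G) (Pi.single 0 (1 : ZMod (2 * S + 1)) : Site 4 (2 * S + 1))) with hσdef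
  have hσ : Measurable σ := (torusConfigShift _).measurable
  have hΘτ : ∀ U : GaugeConfig 4 (2 * S + 1) G,
      torusTimeShift (2 * S + 1) 1 U.negReflect = (σ U).negReflect := by
    intro U
    rw [Hankel.coe_torusTimeShift_one]
    have h := torusConfigShift_negReflect_comm (G := G) (-1 : ZMod (2 * S + 1)) U
    rw [Pi.single_neg, neg_neg] at h
    exact h
  have hστ : ∀ U : GaugeConfig 4 (2 * S + 1) G, σ (torusTimeShift (2 * S + 1) 1 U) = U := by
    intro U
    rw [Hankel.coe_torusTimeShift_one]
    exact Summit.QuantumFields.YangMills.Theorems.FiniteSusceptibilityWeakCoupling.RPCauchySchwarz.torusConfigShift_shift_neg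
      (Pi.single 0 1) U
  -- the reflection-positive class: bounded measurable observables of the slab `1 … S`
  set Good : (GaugeConfig 4 (2 * S + 1) G → ℂ) → Prop := fun Z => Measurable Z ∧ (∃ B, ∀ U, ‖Z U‖ ≤ B) ∧
    DependsOn Z {e : Edge 4 (2 * S + 1) | 1 ≤ (e.1 0).val ∧ (e.1 0).val ≤ S} with hGood
  have hmeas : ∀ Z, Good Z → Measurable Z := fun Z h => h.1
  have hbdd : ∀ Z, Good Z → ∃ B, ∀ U, ‖Z U‖ ≤ B := fun Z h => h.2.1
  have hadd : ∀ Z Y (c : ℂ), Good Z → Good Y → Good (Z + c • Y) := by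
    rintro Z Y c ⟨hZm, ⟨BZ, hBZ⟩, hZd⟩ ⟨hYm, ⟨BY, hBY⟩, hYd⟩
    refine ⟨hZm.add (hYm.const_smul c), ⟨BZ + ‖c‖ * BY, fun U => ?_⟩, fun U V h => ?_⟩
    · rw [Pi.add_apply, Pi.smul_apply, smul_eq_mul]
      refine (norm_add_le _ _).trans (add_le_add (hBZ U) ?_)
      rw [norm_mul]
      exact mul_le_mul_of_nonneg_left (hBY U) (norm_nonneg _)
    · simp only [Pi.add_apply, Pi.smul_apply, smul_eq_mul]
      rw [hZd h, hYd h]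
  have hvar : ∀ Z, Good Z → 0 ≤ osVar μ GaugeConfig.negReflect Z := fun Z h =>
    osVar_negReflect_nonneg_of_rp ρ hρ β hRP h.1 h.2.1 le_rfl h.2.2
  -- `X` and its admissible shifts are good
  obtain ⟨B, hB⟩ := hXb
  have hgoodShift : ∀ n, n + w ≤ S → Good (X ∘ (⇑(torusTimeShift (G := G) (2 * S + 1) 1))^[n]) := by
    intro n hn
    rw [Hankel.torusTimeShift_one_iterate]
    refine ⟨hX.comp (torusTimeShift _ _).measurable, ⟨B, fun U => hB _⟩, ?_⟩
    have h1 := Hankel.dependsOn_comp_torusTimeShift hXd n (by omega)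
    exact h1.mono (slab_subset_slab (by omega) (by omega))
  have hXgood : Good X := by simpa using hgoodShift 0 (by omega)
  have hgood : ∀ j ≤ J, Good (X ∘ (⇑(torusTimeShift (G := G) (2 * S + 1) 1))^[2 ^ j * m]) := by
    intro j hj
    apply hgoodShift
    have : 2 ^ j * m ≤ 2 ^ J * m := Nat.mul_le_mul_right _ (Nat.pow_le_pow_right (by norm_num) hj)
    omega
  have h := norm_osCorr_iterate_pow_le hΘm hΘ hΘΘ hτ hσ hΘτ hστ hmeas hbdd hadd hvar hXgood J m hgood
  simpa only [Hankel.torusTimeShift_one_iterate] using h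

/-- **OS-currency decay from far-separation decay, site reflection.** Under the hypotheses of
`norm_osCorr_negReflect_pow_le`, ANY far bound `‖osCorr μ Θ₀ τ_(2^J m) X X‖ ≤ C e^{−κ 2^J m}`
(e.g. sup-norm exponential clustering of the torus state) gives
`‖osCorr μ Θ₀ τ_m X X‖ ≤ ((osVar μ Θ₀ X)^(2^J − 1) C)^{2^{−J}} e^{−κ m}` — the reflected
autocorrelation in OS currency at the same rate, up to the loss factor `(C / osVar X)^{2^{−J}}`.
[cite: FrohlichIsraelLiebSimon1978, §2] [cite: GlimmJaffe1987, §19.7] -/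
theorem norm_osCorr_negReflect_le_of_decay (hρ : Continuous ρ) (β : ℝ)
    (hRP : ∀ (F : GaugeConfig 4 (2 * S + 1) G → ℂ), Measurable F → (∃ C : ℝ, ∀ U, ‖F U‖ ≤ C) →
      ∀ {w : ℕ}, w ≤ S → DependsOn F {e : Edge 4 (2 * S + 1) | 1 ≤ (e.1 0).val ∧ (e.1 0).val ≤ w} →
        0 ≤ wilsonExpectation ρ β fun U => conj (F U.negReflect) * F U)
    {X : GaugeConfig 4 (2 * S + 1) G → ℂ} (hX : Measurable X) (hXb : ∃ B, ∀ U, ‖X U‖ ≤ B) {w : ℕ}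
    (hXd : DependsOn X {e : Edge 4 (2 * S + 1) | 1 ≤ (e.1 0).val ∧ (e.1 0).val ≤ w})
    {J m : ℕ} (hJm : 2 ^ J * m + w ≤ S) {C κ : ℝ}
    (hfar : ‖osCorr (wilsonMeasure (d := 4) (L := 2 * S + 1) ρ β) GaugeConfig.negReflect
        (torusTimeShift (2 * S + 1) (2 ^ J * m)) X X‖ ≤ C * Real.exp (-(κ * (2 ^ J * m)))) :
    ‖osCorr (wilsonMeasure (d := 4) (L := 2 * S + 1) ρ β) GaugeConfig.negReflect
        (torusTimeShift (2 * S + 1) m) X X‖ ≤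
      (osVar (wilsonMeasure (d := 4) (L := 2 * S + 1) ρ β) GaugeConfig.negReflect X ^ (2 ^ J - 1) * C) ^
          ((2 ^ J : ℝ)⁻¹) * Real.exp (-(κ * m)) := by
  -- adapted from `…TransferHankelTorus` (`norm_osCorr_timeShift_le_of_decay`)
  have hiter := norm_osCorr_negReflect_pow_le ρ hρ β hRP hX hXb hXd hJm
  have hV : 0 ≤ osVar (wilsonMeasure (d := 4) (L := 2 * S + 1) ρ β) GaugeConfig.negReflect X := by
    have : w ≤ S := by have := Nat.zero_le (2 ^ J * m); omega
    exact osVar_negReflect_nonneg_of_rp ρ hρ β hRP hX hXb this hXd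
  set x := ‖osCorr (wilsonMeasure (d := 4) (L := 2 * S + 1) ρ β) GaugeConfig.negReflect
        (torusTimeShift (2 * S + 1) m) X X‖ with hx
  set V := osVar (wilsonMeasure (d := 4) (L := 2 * S + 1) ρ β) GaugeConfig.negReflect X with hVdef
  have hN : (2 ^ J : ℕ) ≠ 0 := by positivity
  have hexp : Real.exp (-(κ * (2 ^ J * m))) = Real.exp (-(κ * m)) ^ (2 ^ J : ℕ) := by
    rw [← Real.exp_nat_mul]; congr 1; push_cast; ring
  have hmain : x ^ (2 ^ J : ℕ) ≤ (V ^ (2 ^ J - 1) * C) * Real.exp (-(κ * m)) ^ (2 ^ J : ℕ) := by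
    refine hiter.trans ?_
    rw [mul_assoc]
    refine mul_le_mul_of_nonneg_left ?_ (by positivity)
    rw [← hexp]; exact hfar
  have hE : 0 < Real.exp (-(κ * m)) := Real.exp_pos _
  have hq : (x / Real.exp (-(κ * m))) ^ (2 ^ J : ℕ) ≤ V ^ (2 ^ J - 1) * C := by
    rw [div_pow, div_le_iff₀ (by positivity)]
    exact hmain
  have hx0 : 0 ≤ x / Real.exp (-(κ * m)) := div_nonneg (norm_nonneg _) hE.le
  have hroot : x / Real.exp (-(κ * m)) ≤ (V ^ (2 ^ J - 1) * C) ^ ((2 ^ J : ℝ)⁻¹) := by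
    have h1 : ((x / Real.exp (-(κ * m))) ^ (2 ^ J : ℕ)) ^ (((2 ^ J : ℕ) : ℝ)⁻¹)
        ≤ (V ^ (2 ^ J - 1) * C) ^ (((2 ^ J : ℕ) : ℝ)⁻¹) :=
      Real.rpow_le_rpow (pow_nonneg hx0 _) hq (by positivity)
    rw [Real.pow_rpow_inv_natCast hx0 hN] at h1
    simpa using h1
  rw [div_le_iff₀ hE] at hroot
  simpa using hroot

end Main

end HankelSite

end Transfer

end Summit.QuantumFields.YangMills.Cruxes.LatticeGapOnTrajectory.OrbitKantorovichFiniteSize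

end
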